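import Mathlib.Algebra.BigOperators.Fin
import Mathlib.Algebra.Order.BigOperators.Ring.Finset
import Mathlib.Data.Real.Basic
import Mathlib.Algebra.BigOperators.Ring.Finset
import Mathlib.Data.Fintype.Pi
import Mathlib.Tactic
import HarnessLib

/-!
# `NoHeavyLowerTail` (crux stmt-CriticalPhenomena-4575), certificate programme for the one-cut bound at
# `|A| = 5`: the algebra of degree-2 (two-copy) Bernstein certificates for multilinear polynomials

Generic, measure-free layer (certificate miner prim-cert-2).  A MULTILINEAR polynomial in `m` variables is
given by its corner table `T : (Fin m → Bool) → R`: `ML T x = Σ_g T g · mono x g`,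
`mono x g = Π_i (x_i if g_i else 1 − x_i)`.  Every bond-percolation probability on a finite graph is of this
form in the edge weights (corner values = deterministic configurations).

* `ML_mul_ML`: the product of two multilinear polynomials regroups over the `3^m` KEYS `k : Fin m → Fin 3`
  (`k_i = g_i + h_i`): `ML A x · ML B x = Σ_k pcoef A B k · Π_i bern (x_i) (k_i)` with the degree-2 Bernstein
  weights `bern t 0 = (1−t)², bern t 1 = t(1−t), bern t 2 = t²` (nonnegative on `[0,1]`) and the FIBRE SUMS
  `pcoef A B k = Σ_{key g h = k} A g · B h`.  The same regrouping with weights `M^{e3 g}` (`sum_mul_sum_key`) is the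
  Kronecker form used by the computable checker.
* `certForm_nonneg`: if every fibre sum of `F = Σ_p ML (Λ p) · ML (T p) − ML C · ML H` is `≥ 0` then `F x ≥ 0`
  on the unit cube.
* `le_of_certificate`: the logical step — nonnegative multipliers `λ_p` with `Σ λ_p > 0`, `c ≥ 0`, a hypothesis
  `E ≥ 0` and `Σ_p λ_p (D_p − L) − c·E ≥ 0` give `L ≤ t` whenever all `D_p ≤ t`.
* `ML_box`: restriction to a sub-box `x_i = a_i + (b_i − a_i) t_i` is again multilinear in `t` with the transformed
  table `boxT a b T g = ML T (corner a b g)` (de Casteljau), so certificates can be given box by box.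

Nothing here mentions percolation or the crux; no proposition about the crux is asserted.
-/

namespace Summit.CriticalPhenomena.PercolationContinuityZ3.Theorems.OneCutCert

open Finset
open scoped BigOperators

variable {m : ℕ}

/-! ## Multilinear polynomials by corner tables -/

/-- The weight of the corner `g` at the point `x`: `Π_i (x_i if g_i else 1 − x_i)`. [this work] -/
def mono (x : Fin m → ℝ) (g : Fin m → Bool) : ℝ := ∏ i, (if g i then x i else 1 - x i)

/-- The multilinear polynomial with corner table `T`, evaluated at `x`. [this work] -/
def ML (T : (Fin m → Bool) → ℝ) (x : Fin m → ℝ) : ℝ := ∑ g, T g * mono x g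

/-- The unit cube. [this work] -/
def InCube (x : Fin m → ℝ) : Prop := ∀ i, 0 ≤ x i ∧ x i ≤ 1

/-- Corner weights are nonnegative on the cube. [folklore] -/
theorem mono_nonneg {x : Fin m → ℝ} (hx : InCube x) (g : Fin m → Bool) : 0 ≤ mono x g := by
  unfold mono
  refine Finset.prod_nonneg fun i _ => ?_
  split_ifs
  · exact (hx i).1
  · exact sub_nonneg.2 (hx i).2

/-- A multilinear polynomial with nonnegative corner table is nonnegative on the cube. [folklore] -/
theorem ML_nonneg {T : (Fin m → Bool) → ℝ} (hT : ∀ g, 0 ≤ T g) {x : Fin m → ℝ} (hx : InCube x) :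
    0 ≤ ML T x :=
  Finset.sum_nonneg fun g _ => mul_nonneg (hT g) (mono_nonneg hx g)

/-- The corner weights sum to one: `Σ_g mono x g = Π_i (x_i + (1 − x_i)) = 1`. [folklore] -/
theorem sum_mono (x : Fin m → ℝ) : ∑ g, mono x g = 1 := by
  have h : ∏ i : Fin m, ∑ b : Bool, (if b then x i else 1 - x i) = ∑ g : Fin m → Bool, mono x g := by
    rw [Finset.prod_univ_sum]
    rfl
  rw [← h]
  refine Finset.prod_eq_one fun i _ => ?_
  rw [Fintype.sum_bool]
  simp

/-- `ML` of a constant table is the constant. [folklore] -/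
theorem ML_const (c : ℝ) (x : Fin m → ℝ) : ML (fun _ => c) x = c := by
  unfold ML
  rw [← Finset.mul_sum, sum_mono, mul_one]

/-- `ML` is additive in the table. [folklore] -/
theorem ML_add (T₁ T₂ : (Fin m → Bool) → ℝ) (x : Fin m → ℝ) :
    ML (fun g => T₁ g + T₂ g) x = ML T₁ x + ML T₂ x := by
  unfold ML
  rw [← Finset.sum_add_distrib]
  exact Finset.sum_congr rfl fun g _ => by ring

/-- `ML` is homogeneous in the table. [folklore] -/
theorem ML_smul (c : ℝ) (T : (Fin m → Bool) → ℝ) (x : Fin m → ℝ) :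
    ML (fun g => c * T g) x = c * ML T x := by
  unfold ML
  rw [Finset.mul_sum]
  exact Finset.sum_congr rfl fun g _ => by ring

/-- `ML (T₁ − T₂) = ML T₁ − ML T₂`. [folklore] -/
theorem ML_sub (T₁ T₂ : (Fin m → Bool) → ℝ) (x : Fin m → ℝ) :
    ML (fun g => T₁ g - T₂ g) x = ML T₁ x - ML T₂ x := by
  unfold ML
  rw [← Finset.sum_sub_distrib]
  exact Finset.sum_congr rfl fun g _ => by ring

/-! ## Keys and the degree-2 Bernstein weights -/

/-- The digit of a pair of bits: `b₁ + b₂ ∈ {0,1,2}`. [this work] -/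
def bkey : Bool → Bool → Fin 3
  | false, false => 0
  | true, false => 1
  | false, true => 1
  | true, true => 2

/-- `bkey` is the sum of the two bits. [this work] -/
theorem bkey_val (b₁ b₂ : Bool) : (bkey b₁ b₂).val = b₁.toNat + b₂.toNat := by
  cases b₁ <;> cases b₂ <;> rfl

/-- The key of a pair of corners: `k_i = g_i + h_i ∈ {0,1,2}`. [this work] -/
def key (g h : Fin m → Bool) : Fin m → Fin 3 := fun i => bkey (g i) (h i)

/-- The degree-2 Bernstein weight of a digit: `(1−t)², t(1−t), t²`. [this work] -/
def bern (t : ℝ) (d : Fin 3) : ℝ := if d.val = 0 then (1 - t) ^ 2 else if d.val = 1 then t * (1 - t) else t ^ 2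

/-- The Bernstein weights are nonnegative on `[0,1]`. [folklore] -/
theorem bern_nonneg {t : ℝ} (ht : 0 ≤ t ∧ t ≤ 1) (d : Fin 3) : 0 ≤ bern t d := by
  unfold bern
  split_ifs
  · exact sq_nonneg _
  · exact mul_nonneg ht.1 (sub_nonneg.2 ht.2)
  · exact sq_nonneg _

/-- The product of two corner weights depends only on the key. [this work] -/
theorem mono_mul_mono (x : Fin m → ℝ) (g h : Fin m → Bool) :
    mono x g * mono x h = ∏ i, bern (x i) (key g h i) := by
  unfold mono
  rw [← Finset.prod_mul_distrib]
  refine Finset.prod_congr rfl fun i _ => ?_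
  unfold key
  rcases Bool.eq_false_or_eq_true (g i) with hg | hg <;>
    rcases Bool.eq_false_or_eq_true (h i) with hh | hh <;>
    simp [hg, hh, bkey, bern] <;> ring

/-- The fibre sum of the key `k`: `Σ_{key g h = k} A g · B h`. [this work] -/
def pcoef {R : Type*} [CommRing R] (A B : (Fin m → Bool) → R) (k : Fin m → Fin 3) : R :=
  ∑ g, ∑ h, if key g h = k then A g * B h else 0

open Classical in
/-- **Regrouping by keys.** If `φ g · ψ h` depends only on the key, the product of the two weighted sums is
the key-indexed sum of the fibre sums. [this work] -/
theorem sum_mul_sum_key {R : Type*} [CommRing R] (A B : (Fin m → Bool) → R) (φ ψ : (Fin m → Bool) → R)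
    (W : (Fin m → Fin 3) → R) (hW : ∀ g h, φ g * ψ h = W (key g h)) :
    (∑ g, A g * φ g) * (∑ h, B h * ψ h) = ∑ k, pcoef A B k * W k := by
  rw [Finset.sum_mul_sum]
  have h1 : ∀ g h : Fin m → Bool, A g * φ g * (B h * ψ h) =
      ∑ k : Fin m → Fin 3, (if key g h = k then A g * B h else 0) * W k := by
    intro g h
    simp_rw [ite_mul, zero_mul]
    rw [Finset.sum_ite_eq, if_pos (Finset.mem_univ _), ← hW g h]
    ring
  simp_rw [h1]
  calc ∑ g, ∑ h, ∑ k, (if key g h = k then A g * B h else 0) * W k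
      = ∑ g, ∑ k, ∑ h, (if key g h = k then A g * B h else 0) * W k :=
        Finset.sum_congr rfl fun g _ => Finset.sum_comm
    _ = ∑ k, ∑ g, ∑ h, (if key g h = k then A g * B h else 0) * W k := Finset.sum_comm
    _ = ∑ k, pcoef A B k * W k := by
        unfold pcoef
        refine Finset.sum_congr rfl fun k _ => ?_
        rw [Finset.sum_mul]
        exact Finset.sum_congr rfl fun g _ => by rw [Finset.sum_mul]

/-- **Product of two multilinear polynomials in the degree-2 Bernstein basis.** [this work] -/
theorem ML_mul_ML (A B : (Fin m → Bool) → ℝ) (x : Fin m → ℝ) :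
    ML A x * ML B x = ∑ k, pcoef A B k * ∏ i, bern (x i) (k i) := by
  unfold ML
  exact sum_mul_sum_key A B (mono x) (mono x) (fun k => ∏ i, bern (x i) (k i)) (mono_mul_mono x)

/-! ## The certificate form and its nonnegativity -/

/-- The degree-2 certificate form `Σ_p ML (Λ p) · ML (T p) − ML C · ML H`. [this work] -/
def certForm {P : Type*} [Fintype P] (Λ T : P → (Fin m → Bool) → ℝ) (C H : (Fin m → Bool) → ℝ)
    (x : Fin m → ℝ) : ℝ :=
  ∑ p, ML (Λ p) x * ML (T p) x - ML C x * ML H x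

/-- The fibre sums of the certificate form. [this work] -/
def certCoef {P : Type*} [Fintype P] (Λ T : P → (Fin m → Bool) → ℝ) (C H : (Fin m → Bool) → ℝ)
    (k : Fin m → Fin 3) : ℝ :=
  ∑ p, pcoef (Λ p) (T p) k - pcoef C H k

/-- The certificate form in the degree-2 Bernstein basis. [this work] -/
theorem certForm_eq {P : Type*} [Fintype P] (Λ T : P → (Fin m → Bool) → ℝ) (C H : (Fin m → Bool) → ℝ)
    (x : Fin m → ℝ) :
    certForm Λ T C H x = ∑ k, certCoef Λ T C H k * ∏ i, bern (x i) (k i) := by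
  unfold certForm certCoef
  simp_rw [ML_mul_ML, sub_mul, Finset.sum_mul]
  rw [Finset.sum_sub_distrib, Finset.sum_comm]

/-- **Fibrewise nonnegativity implies nonnegativity on the cube.** [this work] -/
theorem certForm_nonneg {P : Type*} [Fintype P] {Λ T : P → (Fin m → Bool) → ℝ}
    {C H : (Fin m → Bool) → ℝ} (hk : ∀ k, 0 ≤ certCoef Λ T C H k) {x : Fin m → ℝ} (hx : InCube x) :
    0 ≤ certForm Λ T C H x := by
  rw [certForm_eq]
  exact Finset.sum_nonneg fun k _ =>
    mul_nonneg (hk k) (Finset.prod_nonneg fun i _ => bern_nonneg (hx i) (k i))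

/-! ## The logical step -/

/-- **From a certificate to the bound.** Nonnegative multipliers with positive sum, a nonnegative
hypothesis value `E` and `Σ_p λ_p (D_p − L) − c·E ≥ 0` give `L ≤ t` as soon as every `D_p ≤ t`. [this work] -/
theorem le_of_certificate {P : Type*} [Fintype P] {lam D : P → ℝ} {c E L t : ℝ}
    (hlam : ∀ p, 0 ≤ lam p) (hpos : 0 < ∑ p, lam p) (hc : 0 ≤ c) (hE : 0 ≤ E)
    (hF : 0 ≤ ∑ p, lam p * (D p - L) - c * E) (ht : ∀ p, D p ≤ t) : L ≤ t := by
  have h1 : ∑ p, lam p * (D p - L) ≤ ∑ p, lam p * (t - L) :=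
    Finset.sum_le_sum fun p _ => mul_le_mul_of_nonneg_left (sub_le_sub_right (ht p) L) (hlam p)
  rw [← Finset.sum_mul] at h1
  have h2 : 0 ≤ (∑ p, lam p) * (t - L) := by nlinarith [mul_nonneg hc hE]
  nlinarith

/-! ## Sub-boxes (de Casteljau) -/

/-- The corner point of the box `[a,b]` selected by `g`. [this work] -/
def corner (a b : Fin m → ℝ) (g : Fin m → Bool) : Fin m → ℝ := fun i => if g i then b i else a i

/-- The corner table of the restriction to the box `[a,b]`: the values at the box corners. [this work] -/
def boxT (a b : Fin m → ℝ) (T : (Fin m → Bool) → ℝ) : (Fin m → Bool) → ℝ := fun g => ML T (corner a b g)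

/-- **Restriction to a box is multilinear in the box coordinates**:
`ML T (a + (b − a)·t) = ML (boxT a b T) t`. [folklore] -/
theorem ML_box (a b : Fin m → ℝ) (T : (Fin m → Bool) → ℝ) (t : Fin m → ℝ) :
    ML T (fun i => a i + (b i - a i) * t i) = ML (boxT a b T) t := by
  -- expand each factor `(1−t_i)·α_i + t_i·β_i` of `mono (a+(b−a)t) g` over `h : Fin m → Bool`
  have hmono : ∀ g : Fin m → Bool, mono (fun i => a i + (b i - a i) * t i) g =
      ∑ h : Fin m → Bool, mono t h * mono (corner a b h) g := by
    intro g
    have : ∀ h : Fin m → Bool, mono t h * mono (corner a b h) g =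
        ∏ i, (if h i then t i else 1 - t i) * (if g i then corner a b h i else 1 - corner a b h i) := by
      intro h; unfold mono; rw [← Finset.prod_mul_distrib]
    simp_rw [this]
    have hps : ∏ i : Fin m, ∑ c : Bool, (if c then t i else 1 - t i) *
        (if g i then corner a b (fun j => if j = i then c else false) i
          else 1 - corner a b (fun j => if j = i then c else false) i) =
        ∑ h : Fin m → Bool, ∏ i, (if h i then t i else 1 - t i) *
          (if g i then corner a b h i else 1 - corner a b h i) := by
      rw [Finset.prod_univ_sum]
      have huniv : (Fintype.piFinset fun _ : Fin m => (Finset.univ : Finset Bool)) = Finset.univ :=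
        Fintype.piFinset_univ
      refine Finset.sum_congr huniv fun h _ => Finset.prod_congr rfl fun i _ => ?_
      simp [corner]
    rw [← hps]
    unfold mono
    refine Finset.prod_congr rfl fun i _ => ?_
    rw [Fintype.sum_bool]
    rcases Bool.eq_false_or_eq_true (g i) with hg | hg <;> simp [hg, corner] <;> ring
  unfold ML boxT
  simp_rw [hmono, Finset.mul_sum]
  rw [Finset.sum_comm]
  refine Finset.sum_congr rfl fun h _ => ?_
  unfold ML
  rw [Finset.sum_mul]
  exact Finset.sum_congr rfl fun g _ => by ring

/-- Box coordinates of a point of the box lie in the unit cube. [folklore] -/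
theorem inCube_boxCoord {a b x : Fin m → ℝ} (hab : ∀ i, a i < b i) (hx : ∀ i, a i ≤ x i ∧ x i ≤ b i) :
    InCube (fun i => (x i - a i) / (b i - a i)) := fun i =>
  ⟨div_nonneg (sub_nonneg.2 (hx i).1) (sub_pos.2 (hab i)).le,
    (div_le_one (sub_pos.2 (hab i))).2 (sub_le_sub_right (hx i).2 _)⟩

/-- A point of the box in terms of its box coordinates. [folklore] -/
theorem boxCoord_eq {a b x : Fin m → ℝ} (hab : ∀ i, a i < b i) :
    (fun i => a i + (b i - a i) * ((x i - a i) / (b i - a i))) = x := by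
  funext i
  have : b i - a i ≠ 0 := (sub_pos.2 (hab i)).ne'
  field_simp
  ring

end Summit.CriticalPhenomena.PercolationContinuityZ3.Theorems.OneCutCert
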